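import Literature.Analysis.FluidPDE.FluidComputer.LatticeSymmetry

/-!
# The lattice point group preserves the cubic masks: the persistence theorems apply to the engines' mode sets
# with no side condition

HONEST FRAMING (cell `pub-fluidc`, verbatim): *low prior, high value-of-information experiment on Tao's machine
paradigm; NOT a claim that NS blows up.* Typed bookkeeping about the finite Galerkin system a dealiased
pseudo-spectral code integrates; nothing about the Navier–Stokes PDE.

The persistence theorems of `LatticeSymmetry` (`LatticeIsometry.act_eq_self`, `tg_*_persists`, `kp_*_persists`) and
of the space-group file carry the side conditions `∀ p ∈ S, Mᵀp ∈ S` and `∀ p ∈ S, Mp ∈ S` on the mode set. Both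
engines of the cell step the Galerkin system on the 2/3-rule CUBIC MASK `{k : |k_i| ≤ K}` (`Dealiasing.box K`,
[cite: CanutoEtAl2007, §3.3.2]; `Dealiasing` proved that the dealiased pseudo-spectral product is the exact Galerkin
convolution on it). This file discharges the side conditions for that mask and EVERY element of the point group:

* `LatticeIsometry.sq_le_one`, `abs_eq_sq` (every entry of an integer matrix with orthonormal columns is `−1`, `0`
  or `1`), `sum_abs_col`, `sum_abs_row` (`Σ_i |M_{ij}| = Σ_j |M_{ij}| = 1`: signed permutation matrices);
* `abs_invK_le`, `abs_actK_le` (`Mᵀ` and `M` do not increase the sup norm of a wavevector);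
* **`invK_mem_box`, `actK_mem_box`**: `box K` is mapped into itself by `Mᵀ` and by `M`; `neg_mem_box`;
* **`act_eq_self_box`**: an unforced Galerkin solution supported in `box K` whose datum is `g`-invariant at one
  time is `g`-invariant at all times — for every point-group element `g`, no side condition; instances
  `tg_reflX_persists_box`, `kp_cycleXYZ_persists_box`.

[folklore] 0 sorry, 0 named facts (D-0026).
-/

noncomputable section

namespace Literature.Analysis.FluidPDE.FluidComputer

open Complex ComplexConjugate Finset
open scoped BigOperators

namespace ShellTransfer

namespace LatticeIsometry

variable (g : LatticeIsometry)

/-! ## The point group preserves the cubic masks: the side conditions of the persistence theorems hold for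
the engines' mode sets -/

/-- Every matrix entry of a lattice isometry satisfies `M_{ij}² ≤ 1` (the column `j` has unit norm and the
other two squares are nonnegative). [folklore] -/
theorem sq_le_one (i j : Fin 3) : g.M i j ^ 2 ≤ 1 := by
  have h := g.orth_col j j
  simp only [if_true, Fin.sum_univ_three] at h
  fin_cases i
  · simp only [Fin.zero_eta]
    nlinarith [mul_self_nonneg (g.M 1 j), mul_self_nonneg (g.M 2 j)]
  · simp only [Fin.mk_one]
    nlinarith [mul_self_nonneg (g.M 0 j), mul_self_nonneg (g.M 2 j)]
  · simp only [Fin.reduceFinMk]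
    nlinarith [mul_self_nonneg (g.M 0 j), mul_self_nonneg (g.M 1 j)]

/-- Hence every entry is `-1`, `0` or `1`, so `|M_{ij}| = M_{ij}²`. [folklore] -/
theorem abs_eq_sq (i j : Fin 3) : |g.M i j| = g.M i j ^ 2 := by
  have h := g.sq_le_one i j
  have h1 : g.M i j ≤ 1 := by nlinarith
  have h2 : -1 ≤ g.M i j := by nlinarith
  rcases (show g.M i j = -1 ∨ g.M i j = 0 ∨ g.M i j = 1 by omega) with h | h | h <;> simp [h]

/-- The entries of each column sum in absolute value to `1`. [folklore] -/
theorem sum_abs_col (j : Fin 3) : ∑ i, |g.M i j| = 1 := by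
  have h := g.orth_col j j
  simp only [if_true] at h
  rw [← h]
  refine Finset.sum_congr rfl fun i _ => ?_
  rw [g.abs_eq_sq, sq]

/-- The entries of each row sum in absolute value to `1`. [folklore] -/
theorem sum_abs_row (i : Fin 3) : ∑ j, |g.M i j| = 1 := by
  have h := g.orth_row i i
  simp only [if_true] at h
  rw [← h]
  refine Finset.sum_congr rfl fun j _ => ?_
  rw [g.abs_eq_sq, sq]

/-- **`Mᵀ` does not increase the sup norm**: `|(Mᵀk)_i| ≤ max_j |k_j|`, in the form `(∀ j, |k_j| ≤ K) → |(Mᵀk)_i| ≤ K`.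
[folklore] -/
theorem abs_invK_le {K : ℤ} {k : Fin 3 → ℤ} (hk : ∀ j, |k j| ≤ K) (i : Fin 3) : |g.invK k i| ≤ K := by
  unfold invK
  have hK : 0 ≤ K := le_trans (abs_nonneg _) (hk 0)
  calc |∑ j, g.M j i * k j| ≤ ∑ j, |g.M j i * k j| := Finset.abs_sum_le_sum_abs _ _
    _ = ∑ j, |g.M j i| * |k j| := Finset.sum_congr rfl fun j _ => abs_mul _ _
    _ ≤ ∑ j, |g.M j i| * K :=
        Finset.sum_le_sum fun j _ => mul_le_mul_of_nonneg_left (hk j) (abs_nonneg _)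
    _ = (∑ j, |g.M j i|) * K := by rw [Finset.sum_mul]
    _ = K := by rw [g.sum_abs_col i, one_mul]

/-- `M` does not increase the sup norm either. [folklore] -/
theorem abs_actK_le {K : ℤ} {k : Fin 3 → ℤ} (hk : ∀ j, |k j| ≤ K) (i : Fin 3) : |g.actK k i| ≤ K := by
  unfold actK
  have hK : 0 ≤ K := le_trans (abs_nonneg _) (hk 0)
  calc |∑ j, g.M i j * k j| ≤ ∑ j, |g.M i j * k j| := Finset.abs_sum_le_sum_abs _ _
    _ = ∑ j, |g.M i j| * |k j| := Finset.sum_congr rfl fun j _ => abs_mul _ _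
    _ ≤ ∑ j, |g.M i j| * K :=
        Finset.sum_le_sum fun j _ => mul_le_mul_of_nonneg_left (hk j) (abs_nonneg _)
    _ = (∑ j, |g.M i j|) * K := by rw [Finset.sum_mul]
    _ = K := by rw [g.sum_abs_row i, one_mul]

/-- **THE CUBIC MASK `{|k_i| ≤ K}` IS MAPPED INTO ITSELF BY EVERY POINT-GROUP ELEMENT** (`Mᵀ`): the side
condition `∀ p ∈ S, Mᵀp ∈ S` of the persistence theorems holds for the 2/3-rule mask of both engines
(`Dealiasing.box`). [folklore] -/
theorem invK_mem_box {K : ℕ} {k : Fin 3 → ℤ} (hk : k ∈ Dealiasing.box K) : g.invK k ∈ Dealiasing.box K := by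
  rw [Dealiasing.mem_box] at hk ⊢
  exact fun i => g.abs_invK_le hk i

/-- … and by `M`: the side condition `∀ p ∈ S, Mp ∈ S`. [folklore] -/
theorem actK_mem_box {K : ℕ} {k : Fin 3 → ℤ} (hk : k ∈ Dealiasing.box K) : g.actK k ∈ Dealiasing.box K := by
  rw [Dealiasing.mem_box] at hk ⊢
  exact fun i => g.abs_actK_le hk i

/-- **PERSISTENCE ON THE ENGINES' MASK, no side condition**: an unforced Galerkin solution supported in the cubic
mask `Dealiasing.box K` whose datum is `g`-invariant at one time is `g`-invariant at every time, for EVERY point-group element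
`g`. [folklore] -/
theorem act_eq_self_box {K : ℕ} {U : ℝ → FourierVelocity} {ν : ℝ} {c : ℝ → (Fin 3 → ℤ) → ℂ}
    (hU : IsGalerkinSolution U (Dealiasing.box K) ν c fun _ _ _ => 0) (hs : IsSupportedOn U (Dealiasing.box K)) {t₀ : ℝ}
    (h0 : g.act (U t₀) = U t₀) (t : ℝ) : g.act (U t) = U t :=
  g.act_eq_self hU hs (fun _ hp => g.invK_mem_box hp) (fun _ hp => g.actK_mem_box hp) h0 t

/-- The cubic mask is symmetric under `k ↦ -k`. [folklore] -/
theorem neg_mem_box {K : ℕ} {k : Fin 3 → ℤ} (hk : k ∈ Dealiasing.box K) : -k ∈ Dealiasing.box K := by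
  rw [Dealiasing.mem_box] at hk ⊢
  intro i
  rw [Pi.neg_apply, abs_neg]
  exact hk i

end LatticeIsometry

/-- **Taylor–Green on the engines' mask**: every unforced Galerkin solution supported in `Dealiasing.box K` through `tg` keeps
the mirror symmetry `x ↦ −x` for all times (and likewise every other typed symmetry of the datum). [folklore] -/
theorem tg_reflX_persists_box {K : ℕ} {U : ℝ → FourierVelocity} {ν : ℝ} {c : ℝ → (Fin 3 → ℤ) → ℂ}
    (hU : IsGalerkinSolution U (Dealiasing.box K) ν c fun _ _ _ => 0) (hs : IsSupportedOn U (Dealiasing.box K)) {t₀ : ℝ}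
    (h0 : U t₀ = TaylorGreenHat.tg) (t : ℝ) : reflX.act (U t) = U t :=
  reflX.act_eq_self_box hU hs (by rw [h0, reflX_act_tg]) t

/-- **Kida–Pelz on the engines' mask**: the permutation symmetry persists, no side condition. [folklore] -/
theorem kp_cycleXYZ_persists_box {K : ℕ} {U : ℝ → FourierVelocity} {ν : ℝ} {c : ℝ → (Fin 3 → ℤ) → ℂ}
    (hU : IsGalerkinSolution U (Dealiasing.box K) ν c fun _ _ _ => 0) (hs : IsSupportedOn U (Dealiasing.box K)) {t₀ : ℝ}
    (h0 : U t₀ = KidaPelzHat.kp) (t : ℝ) : cycleXYZ.act (U t) = U t :=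
  cycleXYZ.act_eq_self_box hU hs (by rw [h0, KidaPelzHat.cycleXYZ_act_kp]) t

end ShellTransfer

end Literature.Analysis.FluidPDE.FluidComputer

end
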